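import Literature.Computability.Complexity.CodeFPListKit
import Literature.Computability.Complexity.CodeFPStrings
import Literature.Computability.Complexity.ClayProblem
import Summits.PneNP.PneNP.Theorems.Nc03AvoidResidualCoreCandFewHeadsRungFPSearch

/-!
# Route Nc03AvoidResidualCore — few-heads rung for `CandAvoidLinearFP` (C₁), LITERALLY TYPED, part 3/3: `avoidStr ∈ FP` and the rung `LocalAvoidLinearFP 3 (IsPure candPred ∧ headCount ≤ k)`

Tribunal-w follow-up (D-0033 T3, flag `t3-typing:explicit-avoider` of the judge's amend-1) for
`route-PneNP-Nc03AvoidResidualCore`, item `stmt-PneNP-20226`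
(`CandAvoidLinearFP = LocalAvoidLinearFP 3 (IsPure candPred)`).
`Nc03AvoidResidualCoreCandFewHeadsRung.candFewHeads_rung` proved the few-heads rung with the answer
given as an explicit point `candLocalAvoid I ∉ Range(I)`; here the SAME certificate search is run by a
string function `avoidStr ∈ FP` on the instance code `LocalMap.encode I` (decoder: part 1, search and
correctness: part 2), giving the literal special case

  `candFewHeads_rungFP k : LocalAvoidLinearFP 3 (fun I => I.IsPure candPred ∧ headCount I ≤ k)`

of the crux C₁ — `IsPolyTime`-typed, output read by `readOut` — i.e. exactly C₁ with its side
condition strengthened by `headCount ≤ k` (and C₁ ⇒ rung: `candAvoidLinearFP_imp_fewHeads`).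

TYPING. Every step of `avoidStr` is assembled from the tree's typed `CodeFP` algebra
(`Literature/Computability/Complexity/CodeFP*.lean`): the run-length tokenizer by `foldl₀` with the
linear accumulator bound `length_stE_runState`; decoding by `rawGetD` and `map`; the K1/K3 tests by
`eq`/`natEq`/`and`/`or`/`not` over `rawGetOr` projections; the searches by `rawProduct` + `rawFind?`;
the answer by `optCases` + `map`; the output string by `bitsToStr`; imports kept light (no machine
modules). Hence `avoidStr ∈ FP`
(`avoidStr_mem_FP`), and `FP = IsPolyTime` on string functions (`isPolyTime_iff`).

Placement: a RESTRICTED-MODEL algorithmic rung (pure `CAND`, at most `k` head variables, linear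
stretch) of the range-avoidance ladder; it lies outside the regimes where `NC⁰₃-AVOID ∈ FP` is known
([KuntewarSarma2025, Thms. 2, 8]: monotone / symmetric / `NC⁰₂`; [GuruswamiLyuYuan2025, Thm. 1.3]:
stretch `m ≥ c·n·log n`), it does not decide `Nc03AvoidLinearFP`, and it has no bearing on `P` versus
`NP`.
-/

set_option linter.dupNamespace false -- `Summit.PneNP.PneNP.…`: summit = sub-problem name (D-0017 single-conjunct layout)

namespace Summit.PneNP.PneNP.Theorems.Nc03AvoidResidualCoreCandFewHeadsRungFP

open Literature.Computability.Complexity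
open Summit.PneNP.PneNP.Theorems.Nc03AvoidResidualCoreCandFewHeadsRung

/-! ## `avoidStr` is polynomial time: assembly in the typed `CodeFP` algebra -/

section PolyTime

open CodeFP Polynomial

/-- Code of a token triple (unary numerals). -/
abbrev tripE : ℕ × ℕ × ℕ → List Bool := pairE unE (pairE unE unE)

/-- Code of an output pair (binary indices). -/
abbrev idxE : ℕ × ℕ → List Bool := pairE natE natE

/-- Code of an output quadruple. -/
abbrev quadE : (ℕ × ℕ) × (ℕ × ℕ) → List Bool := pairE idxE idxE

/-- Code of a tokenizer state. -/
abbrev stE : List ℕ × ℕ → List Bool := pairE (rawE unE) unE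

/-- Code of the answer context `(m, outputs)`. -/
abbrev ctxE : ℕ × List (ℕ × ℕ × ℕ) → List Bool := pairE unE (rawE tripE)

/-- The tokenizer step on codes. -/
theorem codeFP_runStep : CodeFP (pairE bitE stE) stE (fun t => runStep t.1 t.2) := by
  have hd : CodeFP (pairE bitE stE) (rawE unE) (fun t => t.2.1) := (snd _ _).fst'
  have hc : CodeFP (pairE bitE stE) unE (fun t => t.2.2) := (snd _ _).snd'
  exact ((fst bitE stE).ite (hd.pair (unSucc.comp hc))
    (((rawAppend unE).comp (hd.pair ((rawSingleton unE).comp hc))).pair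
      (const (pairE bitE stE) (eβ := unE) (0 : ℕ)))).congr fun t => rfl

/-- Consumed bits of a tokenizer state: each closed run `a` cost `a + 1` bits, the open run its length. -/
def wt (s : List ℕ × ℕ) : ℕ := (s.1.map (· + 1)).sum + s.2

/-- The tokenizer consumes exactly one unit of weight per bit read. -/
theorem wt_runState (w : List Bool) : ∀ s, wt (runState w s) = wt s + w.length := by
  induction w with
  | nil => intro s; rfl
  | cons b w ih =>
    intro s
    rw [runState_cons, ih, List.length_cons]
    cases b
    · simp only [runStep_false, wt, List.map_append, List.sum_append, List.map_cons, List.map_nil,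
        List.sum_cons, List.sum_nil]
      omega
    · simp only [runStep_true, wt]
      omega

/-- Length of the raw unary code of a token list. -/
theorem length_rawE_unE (L : List ℕ) : (rawE unE L).length = 2 * (L.map (· + 1)).sum := by
  induction L with
  | nil => rfl
  | cons a L ih =>
    rw [rawE_cons, length_boolPair, length_unE, ih, List.map_cons, List.sum_cons]
    omega

/-- The tokenizer state has a code of length linear in the input read so far. -/
theorem length_stE_runState (l : List Bool) :
    (pairE (rawE unE) unE (runState l ([], 0))).length ≤ 5 * l.length + 2 := by
  have hw := wt_runState l ([], 0)
  simp only [wt, List.map_nil, List.sum_nil, Nat.zero_add] at hw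
  rw [pairE_apply, length_boolPair, length_rawE_unE, length_unE]
  omega

/-- **The tokenizer is polynomial time.** (The folklore first step "a string as the raw list of its
bits" is proved inline — as in `Literature.Barriers.PneNP.AlgebrizationSymmetric` — to keep this
module's import cone at `CodeFPListKit` / `CodeFPStrings` / `ClayProblem`; named copies exist in heavier
modules, e.g. `IoHard.codeFP_strToRaw`.) -/
theorem codeFP_runs : CodeFP strE (rawE unE) runs := by
  have hbits : CodeFP strE (rawE bitE) (fun l : List Bool => l) := by
    have h := strChunks.comp (strLength.pair ((const strE (1 : ℕ)).pair (CodeFP.id strE)))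
    refine h.recodeOut fun l => ?_
    show rawE strE ((List.range l.length).map fun i => (l.drop (i * 1)).take 1) = rawE bitE l
    unfold rawE
    congr 1
    rw [List.map_map]
    apply List.ext_getElem
    · simp
    · intro i h₁ h₂
      rw [List.length_map, List.length_range] at h₁
      simp [bitE, strE, List.take_one_drop_eq_of_lt_length h₁]
  have h := foldl₀ (eα := bitE) (eβ := stE) (step := fun b s => runStep b s) (b₀ := (([] : List ℕ), 0))
    codeFP_runStep (5 * X + 2) (fun l₁ l₂ => by
      have h1 := length_stE_runState l₁
      have h2 : l₁.length ≤ (rawE bitE (l₁ ++ l₂)).length :=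
        le_trans (by simp) (length_le_length_rawE bitE (l₁ ++ l₂))
      have h3 : (5 * X + 2 : Polynomial ℕ).eval (rawE bitE (l₁ ++ l₂)).length =
          5 * (rawE bitE (l₁ ++ l₂)).length + 2 := by
        simp
      rw [h3]
      exact le_trans h1 (by omega))
  exact (h.fst'.comp hbits).congr fun w => rfl

/-- Token access `ts[i]` (`0` past the end). -/
theorem codeFP_getTok : CodeFP (pairE (rawE unE) natE) unE (fun p => p.1.getD p.2 0) :=
  rawGetD unE (d := 0) rfl

/-- Reading `m` (token `1`) is polynomial time. -/
theorem codeFP_mTok : CodeFP (rawE unE) unE (fun ts => ts.getD 1 0) :=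
  (codeFP_getTok.comp ((CodeFP.id _).pair (const (rawE unE) (eβ := natE) (1 : ℕ)))).congr fun _ => rfl

/-- The index arithmetic `7j + c` is polynomial time. -/
theorem codeFP_idx (c : ℕ) : CodeFP (pairE (rawE unE) natE) natE (fun p => 7 * p.2 + c) :=
  (natAdd.comp ((natMul.comp ((const _ (7 : ℕ)).pair (snd _ _))).pair (const _ c))).congr fun _ => rfl

/-- Reading one output off the tokens is polynomial time. -/
theorem codeFP_tripTok : CodeFP (pairE (rawE unE) natE) tripE (fun p => tripTok p.1 p.2) :=
  ((codeFP_getTok.comp ((fst _ _).pair (codeFP_idx 6))).pair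
    ((codeFP_getTok.comp ((fst _ _).pair (codeFP_idx 7))).pair
      (codeFP_getTok.comp ((fst _ _).pair (codeFP_idx 8))))).congr fun _ => rfl

/-- Reading all outputs off the tokens is polynomial time. -/
theorem codeFP_tripsTok : CodeFP (rawE unE) (rawE tripE) tripsTok :=
  ((map codeFP_tripTok).comp ((CodeFP.id _).pair (urange.comp codeFP_mTok))).congr fun _ => rfl

/-- Listing the output pairs is polynomial time. -/
theorem codeFP_pairsR : CodeFP unE (rawE idxE) pairsR :=
  ((rawProduct natE natE).comp (urange.pair urange)).congr fun _ => rfl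

/-- Listing the output quadruples is polynomial time. -/
theorem codeFP_quadsR : CodeFP unE (rawE quadE) quadsR :=
  ((rawProduct idxE idxE).comp (codeFP_pairsR.pair codeFP_pairsR)).congr fun _ => rfl

variable {α : Type} {eα : α → List Bool}

/-- Indexed access to a computed triple list is polynomial time. -/
theorem codeFP_tri {gL : α → List (ℕ × ℕ × ℕ)} {gj : α → ℕ} (hL : CodeFP eα (rawE tripE) gL)
    (hj : CodeFP eα natE gj) : CodeFP eα tripE (fun a => tri (gL a) (gj a)) :=
  ((rawGetOr tripE).comp (hL.pair (hj.pair (const eα (eβ := tripE) ((0 : ℕ), (0 : ℕ), (0 : ℕ)))))).congr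
    fun _ => rfl

/-- Equality of two computed unary numerals is polynomial time. -/
theorem codeFP_eqU {g h : α → ℕ} (hg : CodeFP eα unE g) (hh : CodeFP eα unE h) :
    CodeFP eα bitE (fun a => decide (g a = h a)) :=
  ((CodeFP.eq unE_injective).comp (hg.pair hh)).congr fun _ => rfl

/-- K1 is polynomial time. -/
theorem codeFP_parN : CodeFP (pairE (rawE tripE) idxE) bitE (fun x => parN x.1 x.2) := by
  have ht := codeFP_tri (fst (rawE tripE) idxE) (snd (rawE tripE) idxE).fst'
  have ht' := codeFP_tri (fst (rawE tripE) idxE) (snd (rawE tripE) idxE).snd'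
  exact ((((natEq.comp ((snd (rawE tripE) idxE).fst'.pair (snd (rawE tripE) idxE).snd')).not.and
    (codeFP_eqU ht.fst' ht'.fst')).and
    (((codeFP_eqU ht.snd'.fst' ht'.snd'.fst').and (codeFP_eqU ht.snd'.snd' ht'.snd'.snd')).or
      ((codeFP_eqU ht.snd'.fst' ht'.snd'.snd').and (codeFP_eqU ht.snd'.snd' ht'.snd'.fst'))))).congr
    fun _ => rfl

/-- A K3 link is polynomial time. -/
theorem codeFP_linkO (o₁ o₂ : Bool) :
    CodeFP (pairE (rawE tripE) quadE) bitE (fun x => linkO x.1 x.2 o₁ o₂) := by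
  have hL : CodeFP (pairE (rawE tripE) quadE) (rawE tripE) (fun x => x.1) := fst _ _
  have t11 := codeFP_tri hL (snd (rawE tripE) quadE).fst'.fst'
  have t12 := codeFP_tri hL (snd (rawE tripE) quadE).fst'.snd'
  have t21 := codeFP_tri hL (snd (rawE tripE) quadE).snd'.fst'
  have t22 := codeFP_tri hL (snd (rawE tripE) quadE).snd'.snd'
  have a1 : CodeFP (pairE (rawE tripE) quadE) unE (fun x => (eO (tri x.1 x.2.1.1) o₁).1) := by
    cases o₁
    · exact t11.snd'.fst'.congr fun _ => rfl
    · exact t11.snd'.snd'.congr fun _ => rfl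
  have b1 : CodeFP (pairE (rawE tripE) quadE) unE (fun x => (eO (tri x.1 x.2.1.1) o₁).2) := by
    cases o₁
    · exact t11.snd'.snd'.congr fun _ => rfl
    · exact t11.snd'.fst'.congr fun _ => rfl
  have b2 : CodeFP (pairE (rawE tripE) quadE) unE (fun x => (eO (tri x.1 x.2.1.2) o₂).1) := by
    cases o₂
    · exact t12.snd'.fst'.congr fun _ => rfl
    · exact t12.snd'.snd'.congr fun _ => rfl
  have c2 : CodeFP (pairE (rawE tripE) quadE) unE (fun x => (eO (tri x.1 x.2.1.2) o₂).2) := by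
    cases o₂
    · exact t12.snd'.snd'.congr fun _ => rfl
    · exact t12.snd'.fst'.congr fun _ => rfl
  exact (((codeFP_eqU b1 b2).and ((codeFP_eqU c2 t21.snd'.fst').or (codeFP_eqU c2 t21.snd'.snd'))).and
    ((codeFP_eqU a1 t22.snd'.fst').or (codeFP_eqU a1 t22.snd'.snd'))).congr fun _ => rfl

/-- K3 is polynomial time. -/
theorem codeFP_motN : CodeFP (pairE (rawE tripE) quadE) bitE (fun x => motN x.1 x.2) := by
  have hL : CodeFP (pairE (rawE tripE) quadE) (rawE tripE) (fun x => x.1) := fst _ _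
  have j11 : CodeFP (pairE (rawE tripE) quadE) natE (fun x => x.2.1.1) := (snd _ _).fst'.fst'
  have j12 : CodeFP (pairE (rawE tripE) quadE) natE (fun x => x.2.1.2) := (snd _ _).fst'.snd'
  have j21 : CodeFP (pairE (rawE tripE) quadE) natE (fun x => x.2.2.1) := (snd _ _).snd'.fst'
  have j22 : CodeFP (pairE (rawE tripE) quadE) natE (fun x => x.2.2.2) := (snd _ _).snd'.snd'
  have t11 := codeFP_tri hL j11
  have t12 := codeFP_tri hL j12
  have t21 := codeFP_tri hL j21
  have t22 := codeFP_tri hL j22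
  exact ((((((((codeFP_eqU t12.fst' t11.fst').and (codeFP_eqU t21.fst' t11.fst')).and
    (codeFP_eqU t22.fst' t11.fst')).and (natEq.comp (j12.pair j11)).not).and (natEq.comp (j12.pair j21)).not).and
    (natEq.comp (j22.pair j11)).not).and (natEq.comp (j22.pair j21)).not).and
    ((((codeFP_linkO false false).or (codeFP_linkO false true)).or (codeFP_linkO true false)).or
      (codeFP_linkO true true))).congr fun _ => rfl

/-- The K1 search. -/
theorem codeFP_findPar : CodeFP ctxE (optE idxE) (fun x => (pairsR x.1).find? (parN x.2)) :=
  ((rawFind? codeFP_parN).comp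
    ((snd unE (rawE tripE)).pair (codeFP_pairsR.comp (fst unE (rawE tripE))))).congr fun _ => rfl

/-- The K3 search. -/
theorem codeFP_findMot : CodeFP ctxE (optE quadE) (fun x => (quadsR x.1).find? (motN x.2)) :=
  ((rawFind? codeFP_motN).comp
    ((snd unE (rawE tripE)).pair (codeFP_quadsR.comp (fst unE (rawE tripE))))).congr fun _ => rfl

/-- The answer `0ᵐ` is polynomial time. -/
theorem codeFP_ansNone : CodeFP unE (rawE bitE) ansNone :=
  ((map₀ (const natE (eβ := bitE) false)).comp urange).congr fun _ => rfl

/-- The answer on an optional K3 quadruple is polynomial time. -/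
theorem codeFP_ansQuad : CodeFP (pairE ctxE (optE quadE)) (rawE bitE) (fun p => ansQuad p.1.1 p.2) := by
  have hg : CodeFP (pairE (pairE ctxE quadE) natE) bitE
      (fun u => decide (u.2 = u.1.2.1.1) || decide (u.2 = u.1.2.2.1)) :=
    (natEq.comp ((snd _ _).pair (fst (pairE ctxE quadE) natE).snd'.fst'.fst')).or
      (natEq.comp ((snd _ _).pair (fst (pairE ctxE quadE) natE).snd'.snd'.fst'))
  have hsome : CodeFP (pairE ctxE quadE) (rawE bitE)
      (fun t => (List.range t.1.1).map fun i => decide (i = t.2.1.1) || decide (i = t.2.2.1)) :=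
    ((map hg).comp ((CodeFP.id _).pair (urange.comp (fst ctxE quadE).fst'))).congr fun _ => rfl
  exact optCases (k := fun (s : ℕ × List (ℕ × ℕ × ℕ)) (o : Option ((ℕ × ℕ) × (ℕ × ℕ))) => ansQuad s.1 o)
    (codeFP_ansNone.comp (fst unE (rawE tripE))) hsome (fun _ => rfl) (fun _ _ => rfl)

/-- The answer on an optional K1 pair (with computed fallback) is polynomial time. -/
theorem codeFP_ansPair :
    CodeFP (pairE (pairE ctxE (rawE bitE)) (optE idxE)) (rawE bitE) (fun p => ansPair p.1.1.1 p.1.2 p.2) := by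
  have hg : CodeFP (pairE (pairE (pairE ctxE (rawE bitE)) idxE) natE) bitE
      (fun u => decide (u.2 = u.1.2.1)) :=
    natEq.comp ((snd _ _).pair (fst (pairE (pairE ctxE (rawE bitE)) idxE) natE).snd'.fst')
  have hsome : CodeFP (pairE (pairE ctxE (rawE bitE)) idxE) (rawE bitE)
      (fun t => (List.range t.1.1.1).map fun i => decide (i = t.2.1)) :=
    ((map hg).comp ((CodeFP.id _).pair (urange.comp (fst (pairE ctxE (rawE bitE)) idxE).fst'.fst'))).congr
      fun _ => rfl
  exact optCases
    (k := fun (s : (ℕ × List (ℕ × ℕ × ℕ)) × List Bool) (o : Option (ℕ × ℕ)) => ansPair s.1.1 s.2 o)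
    (snd ctxE (rawE bitE)) hsome (fun _ => rfl) (fun _ _ => rfl)

/-- The answer on token data is polynomial time. -/
theorem codeFP_answer : CodeFP ctxE (rawE bitE) (fun x => answer x.1 x.2) :=
  (codeFP_ansPair.comp
    (((CodeFP.id ctxE).pair (codeFP_ansQuad.comp ((CodeFP.id ctxE).pair codeFP_findMot))).pair
      codeFP_findPar)).congr fun _ => rfl

/-- **The avoider is computed on codes by an `FP` string function** (input and output are plain
strings, `strE = id`). -/
theorem codeFP_avoidStr : CodeFP strE strE avoidStr :=
  (bitsToStr.comp (codeFP_answer.comp ((codeFP_mTok.pair codeFP_tripsTok).comp codeFP_runs))).congr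
    fun _ => rfl

/-- **`avoidStr ∈ FP`.** -/
theorem avoidStr_mem_FP : avoidStr ∈ FP := by
  obtain ⟨f, hf, hfw⟩ := codeFP_avoidStr
  have h : f = avoidStr := funext fun w => hfw w
  rw [← h]
  exact hf

/-- **`avoidStr` is polynomial-time computable** in the sense of `LocalAvoidLinearFP` (`IsPolyTime`,
Mathlib's `TM2ComputableInPolyTime` with identity codes; bridge `isPolyTime_iff`). -/
theorem isPolyTime_avoidStr : IsPolyTime avoidStr := (isPolyTime_iff avoidStr).mpr avoidStr_mem_FP

end PolyTime

/-! ## The rung -/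

/-- **Few-heads rung, literally typed (BC5 / T3 witness for C₁ = `CandAvoidLinearFP`).** For every
`k`, pure-`CAND` `NC⁰₃`-range avoidance restricted to instances with at most `k` head variables is
solved at linear stretch `m ≥ (k+1)·n` by ONE polynomial-time string function: the statement
`LocalAvoidLinearFP 3 (IsPure candPred ∧ headCount ≤ k)`, i.e. the crux C₁ with its side condition
strengthened by `headCount ≤ k`. (Restricted-model algorithmic rung; no bearing on `P ≠ NP`.) -/
theorem candFewHeads_rungFP (k : ℕ) :
    LocalAvoidLinearFP 3 (fun _ _ I => I.IsPure candPred ∧ headCount I ≤ k) := by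
  refine ⟨k + 1, avoidStr, isPolyTime_avoidStr, fun n m I hQ hn hkm => ?_⟩
  rw [avoidStr_encode hQ.1]
  refine answer_not_mem_range hQ.1 (lt_of_lt_of_le ?_ hkm)
  calc headCount I * (n - 1) ≤ k * (n - 1) := Nat.mul_le_mul_right _ hQ.2
    _ ≤ k * n := Nat.mul_le_mul_left k (Nat.sub_le n 1)
    _ < (k + 1) * n := by rw [Nat.succ_mul]; exact Nat.lt_add_of_pos_right hn

end Summit.PneNP.PneNP.Theorems.Nc03AvoidResidualCoreCandFewHeadsRungFP
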